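import Literature.Analysis.FluidPDE.TaoH1FourierMildFamily
import Literature.Analysis.FluidPDE.NSRegFourierSynthesis
import HarnessLib

/-!
# The classical solution synthesized from a Fourier-side `H¹`-mild solution of Sobolev class

Second file of the discharge of `Literature.Analysis.FluidPDE.sobolevMild_classical`
(`TaoH1FourierMild.lean`; T. Tao, Anal. PDE 6 (2013) = arXiv:1108.1165, Thm. 5.4 (iv): "`u` and
`p` are smooth" for the `H¹` mild solution with `H^∞` datum, with the note closing its proof).
Given a heat rate `c = 4π²ν > 0`, a datum `a` of Sobolev class and `v` with
`IsSobolevMild c T a v` on `[0, T]`, `T > 0`, the physical fields are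

  `u(t, x) = synthVel (v t) x = Re 𝓕 v(t)(x)`,  `p(t, x) = Re 𝓕 q(t)(x)`,  `q(t) = presSymbol (v t) (v t)`,

and this file proves that `(u, p)` is a **classical solution of the unforced Navier–Stokes system
on the closed slab `[0, T] × E`** (`IsSobolevMild.isClassicalNSSolutionOn`): joint smoothness from
the square-dominated families of `TaoH1FourierMildFamily` and the synthesis theorem
`contDiffOn_synth_infty_dom` (`NSRegFourierSynthesis`); the equations term by term through the
dictionary (`∂ₜ ↔ -c‖ξ‖² − N`, `∂_h ↔ -2πi⟪ξ, h⟫`, `Δ ↔ -4π²‖ξ‖²`, products ↔ convolutions), here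
with *moment* hypotheses (`∫ ‖ξ‖ᵐ ‖f‖ < ∞`) in place of the pointwise decay of the tree's
`NSFourierDictionary`/`NSFourierSolution`, the incompressibility of `v` and the Fourier-side
identity `G − N − 2πi ξ q = 0` between the transformed convective term, its Leray projection and
the pressure symbol (Leray 1934, §19; Lemarié-Rieusset 2016, §6.1). This is the tree's
`FourierDatum.isClassicalNSSolutionOn` (`NSFourierRestart`) with the pointwise class replaced by
the Sobolev class; no definitions are introduced.

## Mathlib / tree search

Reused: `synthVel`, `ClayDatum.reVec` (`NSFourierSobolev`, `NSFourierSolution`), the dictionary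
`fourier_add'`, `fourier_sub'`, `fourier_const_mul'`, `fourier_finset_sum'`, `fourier_mul_fourier'`,
`fourier_eq_re_of_conj_symm`, `integrable_fourierSMulRight'` (`NSFourierDictionary`),
`contDiffOn_synth_infty_dom`, `hasDerivWithinAt_synth_time_dom` (`NSRegFourierSynthesis`),
`IsSobolevMild.exists_family/_presFamily/_nonlinFamily`, `exists_dom` (`TaoH1FourierMildFamily`).
Mathlib: `Real.fderiv_fourier`, `Real.iteratedFDeriv_fourier`,
`InnerProductSpace.laplacian_eq_iteratedFDeriv_orthonormalBasis`.

## References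

* T. Tao, arXiv:1108.1165 = Anal. PDE 6 (2013), Thm. 5.4 (iv) (arXiv Thm. 31, p. 18). [Tao2011]
* J. Leray, Acta Math. 63 (1934), §19. [Leray1934]
* P. G. Lemarié-Rieusset, *The Navier–Stokes problem in the 21st century*, CRC 2016, §6.1.
-/

noncomputable section

open MeasureTheory Real Set Filter Function Complex FourierTransform VectorFourier
  InnerProductSpace
open scoped FourierTransform RealInnerProductSpace ENNReal ContDiff ComplexConjugate Laplacian
open _root_.Topology

namespace Literature.Analysis.FluidPDE.FourierNS

variable {ι : Type*} [Fintype ι]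

/-! ### The dictionary with moment hypotheses -/

section Dictionary

variable {f : EuclideanSpace ℝ ι → ℂ}

/-- **`∂_h 𝓕 f = 𝓕 (-2πi⟪ξ, h⟫ f)`** for integrable `f` with integrable first moment (Mathlib
`Real.fderiv_fourier`, evaluated). [folklore] -/
theorem fderiv_fourier_apply_of_integrable (hf : Integrable f)
    (hf1 : Integrable fun ξ : EuclideanSpace ℝ ι => ‖ξ‖ * ‖f ξ‖) (x h : EuclideanSpace ℝ ι) :
    fderiv ℝ (𝓕 f) x h = 𝓕 (fun ξ => (-(2 * π * I) * (⟪ξ, h⟫ : ℂ)) * f ξ) x := by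
  rw [Real.fderiv_fourier hf hf1, Real.fourier_continuousLinearMap_apply
    (integrable_fourierSMulRight' hf hf1)]
  have hfun : (fun ξ : EuclideanSpace ℝ ι => fourierSMulRight (innerSL ℝ) f ξ h) =
      fun ξ : EuclideanSpace ℝ ι => (-(2 * π * I) * (⟪ξ, h⟫ : ℂ)) * f ξ := by
    funext ξ
    change -(2 * π * I) • ((⟪ξ, h⟫ : ℝ) • f ξ) = _
    rw [Complex.real_smul, smul_eq_mul]
    ring
  rw [hfun]

/-- **`Δ 𝓕 f = 𝓕 (-4π²‖ξ‖² f)`** for `f` with integrable moments up to order `2` (the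
orthonormal-basis formula for the Laplacian, Mathlib's `iteratedFDeriv_fourier`, `∑ᵢ ξᵢ² = ‖ξ‖²`;
the tree's `laplacian_fourier'` with moment hypotheses). [folklore] -/
theorem laplacian_fourier_of_moments
    (hmom : ∀ m ≤ 2, Integrable fun ξ : EuclideanSpace ℝ ι => ‖ξ‖ ^ m * ‖f ξ‖)
    (hfm : AEStronglyMeasurable f volume) (x : EuclideanSpace ℝ ι) :
    (Δ (𝓕 f)) x = 𝓕 (fun ξ => (-(4 * π ^ 2 * ‖ξ‖ ^ 2 : ℝ) : ℂ) * f ξ) x := by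
  classical
  have hint : Integrable f := (integrable_norm_iff hfm).1 (by simpa using hmom 0 (by norm_num))
  rw [laplacian_eq_iteratedFDeriv_orthonormalBasis (𝓕 f) (EuclideanSpace.basisFun ι ℝ)]
  simp only
  rw [Real.iteratedFDeriv_fourier (N := (2 : ℕ)) (fun m hm => hmom m (mod_cast hm)) hfm
    (n := 2) (mod_cast le_rfl)]
  have hI : Integrable fun ξ => fourierPowSMulRight (innerSL ℝ) f ξ 2 :=
    integrable_fourierPowSMulRight _ (hmom 2 le_rfl) hfm
  set g : ι → EuclideanSpace ℝ ι → ℂ := fun i ξ =>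
    ((-(2 * π * I)) ^ 2 * ((ξ i : ℝ) : ℂ) ^ 2) * f ξ with hg
  have hterm : ∀ i : ι, 𝓕 (fun ξ => fourierPowSMulRight (innerSL ℝ) f ξ 2) x
      ![(EuclideanSpace.basisFun ι ℝ) i, (EuclideanSpace.basisFun ι ℝ) i] = 𝓕 (g i) x := by
    intro i
    rw [Real.fourier_continuousMultilinearMap_apply hI]
    have hfun : (fun ξ : EuclideanSpace ℝ ι => fourierPowSMulRight (innerSL ℝ) f ξ 2
        ![(EuclideanSpace.basisFun ι ℝ) i, (EuclideanSpace.basisFun ι ℝ) i]) = g i := by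
      funext ξ
      rw [fourierPowSMulRight_apply, Fin.prod_univ_two]
      simp only [Matrix.cons_val_zero, Matrix.cons_val_one]
      rw [EuclideanSpace.basisFun_apply]
      change (-(2 * π * I)) ^ 2 • ((⟪ξ, EuclideanSpace.single i (1 : ℝ)⟫ *
        ⟪ξ, EuclideanSpace.single i (1 : ℝ)⟫ : ℝ) • f ξ) = g i ξ
      rw [EuclideanSpace.inner_single_right, Complex.real_smul, smul_eq_mul]
      simp only [hg, conj_trivial, one_mul, Complex.ofReal_mul]
      ring
    rw [hfun]
  simp_rw [hterm]
  have hfi : ∀ i ∈ (Finset.univ : Finset ι), Integrable (g i) := by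
    intro i _
    have h2 := hmom 2 le_rfl
    refine (h2.const_mul (4 * π ^ 2)).mono' ?_ (Eventually.of_forall fun ξ => ?_)
    · exact ((Continuous.aestronglyMeasurable (by fun_prop)).mul hfm)
    · simp only [hg]
      rw [norm_mul, norm_mul, norm_pow, norm_neg, norm_mul, norm_mul, Complex.norm_two,
        Complex.norm_real, Complex.norm_I, mul_one, Real.norm_eq_abs, abs_of_pos Real.pi_pos,
        norm_pow, Complex.norm_real, Real.norm_eq_abs]
      have h1 : |ξ i| ^ 2 ≤ ‖ξ‖ ^ 2 := pow_le_pow_left₀ (abs_nonneg _) (abs_apply_le_norm ξ i) 2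
      calc (2 * π) ^ 2 * |ξ i| ^ 2 * ‖f ξ‖ ≤ (2 * π) ^ 2 * ‖ξ‖ ^ 2 * ‖f ξ‖ := by gcongr
        _ = 4 * π ^ 2 * (‖ξ‖ ^ 2 * ‖f ξ‖) := by ring
  rw [← fourier_finset_sum' Finset.univ hfi]
  have hsum : (fun ξ : EuclideanSpace ℝ ι => ∑ b, g b ξ) =
      fun ξ => (-(4 * π ^ 2 * ‖ξ‖ ^ 2 : ℝ) : ℂ) * f ξ := by
    funext ξ
    change ∑ b, ((-(2 * π * I)) ^ 2 * ((ξ b : ℝ) : ℂ) ^ 2) * f ξ = _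
    rw [← Finset.sum_mul]
    congr 1
    have hI2 : (-(2 * (π : ℂ) * I)) ^ 2 = -(4 * π ^ 2) := by
      rw [neg_sq, mul_pow, mul_pow, Complex.I_sq]; ring
    simp only [hI2]
    rw [← Finset.mul_sum, show (∑ i, ((ξ i : ℝ) : ℂ) ^ 2) = ((∑ i, (ξ i) ^ 2 : ℝ) : ℂ) by
      push_cast; rfl, sum_sq_eq_norm_sq]
    push_cast
    ring
  rw [hsum]

/-- `‖-2πi ξⱼ · g‖ ≤ 2π ‖ξ‖ ‖g‖`: the coordinate-derivative symbol has linear growth. [folklore] -/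
theorem norm_letterSymbol_mul_le (g : EuclideanSpace ℝ ι → ℂ) (j : ι) (ξ : EuclideanSpace ℝ ι) :
    ‖(-(2 * π * I) * ((ξ j : ℝ) : ℂ)) * g ξ‖ ≤ 2 * π * (‖ξ‖ * ‖g ξ‖) := by
  rw [norm_mul, norm_mul, norm_neg, norm_mul, norm_mul, Complex.norm_two, Complex.norm_real,
    Complex.norm_I, mul_one, Real.norm_eq_abs, abs_of_pos Real.pi_pos, Complex.norm_real,
    Real.norm_eq_abs]
  rw [mul_assoc]
  exact mul_le_mul_of_nonneg_left (mul_le_mul_of_nonneg_right (abs_apply_le_norm ξ j)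
    (norm_nonneg _)) (by positivity)

/-- Integrability of `-2πi ξⱼ · g` from the first moment of `g`. [folklore] -/
theorem integrable_letterSymbol_mul {g : EuclideanSpace ℝ ι → ℂ}
    (hg1 : Integrable fun ξ : EuclideanSpace ℝ ι => ‖ξ‖ * ‖g ξ‖) (hgm : AEStronglyMeasurable g volume)
    (j : ι) : Integrable fun ξ : EuclideanSpace ℝ ι => (-(2 * π * I) * ((ξ j : ℝ) : ℂ)) * g ξ :=
  (hg1.const_mul (2 * π)).mono' ((Continuous.aestronglyMeasurable (by fun_prop)).mul hgm)
    (Eventually.of_forall fun ξ => norm_letterSymbol_mul_le g j ξ)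

end Dictionary

/-! ### The solution: integrability of the coefficient slices -/

section Solution

variable [DecidableEq ι]
variable {c T : ℝ} {a : EuclideanSpace ℝ ι → ι → ℂ} {v : ℝ → EuclideanSpace ℝ ι → ι → ℂ}

open ClayDatum (reVec reVec_apply)

/-- **Integrable moments of every order of the components**, uniformly available at every time
(`‖ξ‖^m ‖v(t, ξ)ₗ‖ ≤ G_{m+K₀}(ξ) (1+‖ξ‖)^{-K₀}`, a product of two `L²` functions). [folklore] -/
theorem IsSobolevMild.integrable_pow_mul_norm (h : IsSobolevMild c T a v) (hc : 0 ≤ c)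
    (ha : IsSobolevFourierDatum a) (m : ℕ) (t : ℝ) (l : ι) :
    Integrable fun ξ : EuclideanSpace ℝ ι => ‖ξ‖ ^ m * ‖v t ξ l‖ := by
  set K₀ := Fintype.card ι + 1 with hK₀
  obtain ⟨G, hG, hle⟩ := h.exists_dom hc ha (m + K₀) l
  have hw : MemLp (fun ξ : EuclideanSpace ℝ ι => ((1 + ‖ξ‖) ^ K₀)⁻¹) 2 volume :=
    memLp_inv_one_add_norm_pow_two
  refine (hG.integrable_mul hw).mono' ((continuous_norm.pow m).aestronglyMeasurable.mul
    (h.aesm_apply t l).norm) (Eventually.of_forall fun ξ => ?_)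
  rw [Real.norm_of_nonneg (by positivity)]
  change ‖ξ‖ ^ m * ‖v t ξ l‖ ≤ G ξ * ((1 + ‖ξ‖) ^ K₀)⁻¹
  have hpos : 0 < (1 + ‖ξ‖) ^ K₀ := by positivity
  rw [le_mul_inv_iff₀ hpos]
  have h1 : ‖ξ‖ ^ m ≤ (1 + ‖ξ‖) ^ m :=
    pow_le_pow_left₀ (norm_nonneg _) (le_add_of_nonneg_left zero_le_one) m
  calc ‖ξ‖ ^ m * ‖v t ξ l‖ * (1 + ‖ξ‖) ^ K₀ ≤ (1 + ‖ξ‖) ^ m * ‖v t ξ l‖ * (1 + ‖ξ‖) ^ K₀ := by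
        gcongr
    _ = (1 + ‖ξ‖) ^ (m + K₀) * ‖v t ξ l‖ := by rw [pow_add]; ring
    _ ≤ G ξ := hle t ξ

/-- Components of the solution are integrable at every time. [folklore] -/
theorem IsSobolevMild.integrable_apply (h : IsSobolevMild c T a v) (hc : 0 ≤ c)
    (ha : IsSobolevFourierDatum a) (t : ℝ) (l : ι) : Integrable fun ξ => v t ξ l := by
  have := h.integrable_pow_mul_norm hc ha 0 t l
  simp only [pow_zero, one_mul] at this
  exact (integrable_norm_iff (h.aesm_apply t l)).1 this

/-- The nonlinearity slice has every pointwise decay on `[0, T]`, with measurable slices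
(from the order-`0` nonlinearity family). [folklore] -/
theorem IsSobolevMild.hasDecay_nonlin (h : IsSobolevMild c T a v) (hc : 0 ≤ c) (hT : 0 < T)
    (ha : IsSobolevFourierDatum a) (K : ℕ) (l : ι) :
    ∃ B, ∀ t ∈ Icc 0 T, HasDecay K B (fun ξ => nonlin (v t) (v t) ξ l) ∧
      AEStronglyMeasurable (fun ξ => nonlin (v t) (v t) ξ l) volume := by
  obtain ⟨M, hM0, hM⟩ := h.exists_nonlinFamily hc hT ha 0
  obtain ⟨B, hB⟩ := (hM l).decay 0 le_rfl K
  refine ⟨B, fun t ht => ⟨fun ξ => ?_, ?_⟩⟩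
  · have := hB t ht ξ
    simp only [hM0 t ξ] at this
    exact this
  · have := (hM l).meas 0 le_rfl t ht
    exact this.congr (Eventually.of_forall fun ξ => by simp only [hM0 t ξ])

/-- The pressure symbol has every pointwise decay on `[0, T]`, with measurable slices. [folklore] -/
theorem IsSobolevMild.hasDecay_presSymbol (h : IsSobolevMild c T a v) (hc : 0 ≤ c) (hT : 0 < T)
    (ha : IsSobolevFourierDatum a) (K : ℕ) :
    ∃ B, ∀ t ∈ Icc 0 T, HasDecay K B (presSymbol (v t) (v t)) ∧
      AEStronglyMeasurable (presSymbol (v t) (v t)) volume := by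
  obtain ⟨Q, hQ0, hQ⟩ := h.exists_presFamily hc hT ha 0
  obtain ⟨B, hB⟩ := hQ.decay 0 le_rfl K
  refine ⟨B, fun t ht => ⟨fun ξ => ?_, ?_⟩⟩
  · have := hB t ht ξ
    rwa [hQ0 t ξ] at this
  · have := hQ.meas 0 le_rfl t ht
    exact this.congr (Eventually.of_forall fun ξ => by simp only [hQ0 t ξ])

/-! ### Smoothness on the closed slab -/

/-- **The velocity `u(t) = synthVel (v t)` is jointly smooth on `[0, T] × E`.** [folklore] -/
theorem IsSobolevMild.smooth_u (h : IsSobolevMild c T a v) (hc : 0 ≤ c) (hT : 0 < T)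
    (ha : IsSobolevFourierDatum a) :
    IsSmoothSpaceTimeOn (Icc 0 T) (fun t => synthVel (v t)) := by
  unfold IsSmoothSpaceTimeOn
  refine (contDiffOn_euclidean (ι := ι) (𝕜 := ℝ)).2 fun l => ?_
  have h1 : ContDiffOn ℝ ∞ (fun z : ℝ × EuclideanSpace ℝ ι => 𝓕 (fun ξ => v z.1 ξ l) z.2)
      (Icc 0 T ×ˢ univ) := by
    refine contDiffOn_synth_infty_dom (W₀ := fun t ξ => v t ξ l) hT fun n => ?_
    obtain ⟨W, hW0, hW⟩ := h.exists_family hc hT ha n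
    exact ⟨fun k t ξ => W k t ξ l, by funext t ξ; simp only [hW0], hW l⟩
  exact Complex.reCLM.contDiff.comp_contDiffOn h1

/-- **The pressure `p(t) = Re 𝓕 presSymbol (v t) (v t)` is jointly smooth on `[0, T] × E`.** [folklore] -/
theorem IsSobolevMild.smooth_p (h : IsSobolevMild c T a v) (hc : 0 ≤ c) (hT : 0 < T)
    (ha : IsSobolevFourierDatum a) :
    IsSmoothSpaceTimeOn (Icc 0 T) (fun t x => (𝓕 (presSymbol (v t) (v t)) x).re) := by
  unfold IsSmoothSpaceTimeOn
  have h1 : ContDiffOn ℝ ∞ (fun z : ℝ × EuclideanSpace ℝ ι => 𝓕 (presSymbol (v z.1) (v z.1)) z.2)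
      (Icc 0 T ×ˢ univ) := by
    refine contDiffOn_synth_infty_dom (W₀ := fun t => presSymbol (v t) (v t)) hT fun n => ?_
    obtain ⟨Q, hQ0, hQ⟩ := h.exists_presFamily hc hT ha n
    exact ⟨Q, by funext t ξ; exact hQ0 t ξ, hQ.isDomFamily⟩
  exact Complex.reCLM.contDiff.comp_contDiffOn h1

/-! ### Space derivatives of the velocity -/

/-- The `x`-derivative of a complex velocity component:
`∂_h 𝓕 vₗ(t) = 𝓕 (-2πi⟪ξ,h⟫ vₗ(t))`. [folklore] -/
theorem IsSobolevMild.fderiv_U (h : IsSobolevMild c T a v) (hc : 0 ≤ c)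
    (ha : IsSobolevFourierDatum a) (t : ℝ) (x h' : EuclideanSpace ℝ ι) (l : ι) :
    fderiv ℝ (𝓕 (fun ξ => v t ξ l)) x h' =
      𝓕 (fun ξ => (-(2 * π * I) * (⟪ξ, h'⟫ : ℂ)) * v t ξ l) x := by
  have h1 := h.integrable_pow_mul_norm hc ha 1 t l
  simp only [pow_one] at h1
  exact fderiv_fourier_apply_of_integrable (h.integrable_apply hc ha t l) h1 x h'

/-- Complex velocity components are `C^n` in `x` for every `n`. [folklore] -/
theorem IsSobolevMild.contDiff_U (h : IsSobolevMild c T a v) (hc : 0 ≤ c)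
    (ha : IsSobolevFourierDatum a) (t : ℝ) (l : ι) (n : ℕ) :
    ContDiff ℝ n (𝓕 (fun ξ => v t ξ l)) :=
  Real.contDiff_fourier fun m _ => h.integrable_pow_mul_norm hc ha m t l

/-- The complex velocity vector `x ↦ (𝓕 vₗ(t) x)ₗ` is `C^n`. [folklore] -/
theorem IsSobolevMild.contDiff_Uvec (h : IsSobolevMild c T a v) (hc : 0 ≤ c)
    (ha : IsSobolevFourierDatum a) (t : ℝ) (n : ℕ) :
    ContDiff ℝ n (fun x => fun l => 𝓕 (fun ξ => v t ξ l) x) :=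
  contDiff_pi' fun l => h.contDiff_U hc ha t l n

omit [DecidableEq ι] in
/-- `synthVel (v t) = reVec ∘ (complex components)`. [folklore] -/
theorem synthVel_eq_comp (V₀ : EuclideanSpace ℝ ι → ι → ℂ) :
    synthVel V₀ = reVec ∘ fun x => fun l => 𝓕 (fun ξ => V₀ ξ l) x := rfl

/-- **The velocity gradient**: `(D synthVel (v t) x h)ₗ = Re 𝓕 (-2πi⟪ξ,h⟫ vₗ)(x)`. [folklore] -/
theorem IsSobolevMild.fderiv_u_apply (h : IsSobolevMild c T a v) (hc : 0 ≤ c)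
    (ha : IsSobolevFourierDatum a) (t : ℝ) (x h' : EuclideanSpace ℝ ι) (l : ι) :
    fderiv ℝ (synthVel (v t)) x h' l =
      (𝓕 (fun ξ => (-(2 * π * I) * (⟪ξ, h'⟫ : ℂ)) * v t ξ l) x).re := by
  have hd : DifferentiableAt ℝ (fun x => fun l => 𝓕 (fun ξ => v t ξ l) x) x :=
    (h.contDiff_Uvec hc ha t 1).differentiable (by norm_num) x
  have h1 : HasFDerivAt (synthVel (v t))
      ((reVec (ι := ι)).comp (fderiv ℝ (fun x => fun l => 𝓕 (fun ξ => v t ξ l) x) x)) x := by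
    rw [synthVel_eq_comp]
    exact (reVec (ι := ι)).hasFDerivAt.comp x hd.hasFDerivAt
  rw [h1.fderiv, ContinuousLinearMap.comp_apply, reVec_apply]
  have h2 : fderiv ℝ (fun x => fun l => 𝓕 (fun ξ => v t ξ l) x) x =
      ContinuousLinearMap.pi fun l => fderiv ℝ (𝓕 (fun ξ => v t ξ l)) x :=
    fderiv_pi fun l => ((h.contDiff_U hc ha t l 1).differentiable (by norm_num)) x
  rw [h2, ContinuousLinearMap.pi_apply, h.fderiv_U hc ha]

/-- **The velocity is divergence free** for every `t`. [folklore] -/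
theorem IsSobolevMild.isDivFree_u (h : IsSobolevMild c T a v) (hc : 0 ≤ c)
    (ha : IsSobolevFourierDatum a) (t : ℝ) : VectorCalculus.IsDivFree (synthVel (v t)) := by
  classical
  intro x
  rw [divergence_eq_sum_inner_fderiv (EuclideanSpace.basisFun ι ℝ)]
  have hterm : ∀ l, ⟪(EuclideanSpace.basisFun ι ℝ) l,
      fderiv ℝ (synthVel (v t)) x ((EuclideanSpace.basisFun ι ℝ) l)⟫ =
      (𝓕 (fun ξ => (-(2 * π * I) * ((ξ l : ℝ) : ℂ)) * v t ξ l) x).re := by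
    intro l
    rw [EuclideanSpace.basisFun_apply, EuclideanSpace.inner_single_left, h.fderiv_u_apply hc ha]
    simp only [conj_trivial, one_mul, EuclideanSpace.inner_single_right]
  simp_rw [hterm]
  rw [← Complex.re_sum]
  have hint : ∀ l ∈ (Finset.univ : Finset ι), Integrable fun ξ : EuclideanSpace ℝ ι =>
      (-(2 * π * I) * ((ξ l : ℝ) : ℂ)) * v t ξ l := fun l _ => by
    have h1 := h.integrable_pow_mul_norm hc ha 1 t l
    simp only [pow_one] at h1
    exact integrable_letterSymbol_mul h1 (h.aesm_apply t l) l
  rw [← fourier_finset_sum' Finset.univ hint]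
  have hzero : (fun ξ : EuclideanSpace ℝ ι => ∑ l, (-(2 * π * I) * ((ξ l : ℝ) : ℂ)) * v t ξ l) =
      fun _ => 0 := by
    funext ξ
    have := h.divFree t ξ
    calc ∑ l, (-(2 * π * I) * ((ξ l : ℝ) : ℂ)) * v t ξ l
        = -(2 * π * I) * ∑ l, ((ξ l : ℝ) : ℂ) * v t ξ l := by
          rw [Finset.mul_sum]; refine Finset.sum_congr rfl fun l _ => ?_; ring
      _ = 0 := by rw [this, mul_zero]
  rw [hzero, fourier_zero', Complex.zero_re]

/-- **The Laplacian of the velocity**: `(Δ synthVel (v t) x)ₗ = Re 𝓕 (-4π²‖ξ‖² vₗ)(x)`. [folklore] -/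
theorem IsSobolevMild.laplacian_u_apply (h : IsSobolevMild c T a v) (hc : 0 ≤ c)
    (ha : IsSobolevFourierDatum a) (t : ℝ) (x : EuclideanSpace ℝ ι) (l : ι) :
    (Δ (synthVel (v t))) x l =
      (𝓕 (fun ξ => (-(4 * π ^ 2 * ‖ξ‖ ^ 2 : ℝ) : ℂ) * v t ξ l) x).re := by
  have h2 : ContDiffAt ℝ 2 (fun x => fun l => 𝓕 (fun ξ => v t ξ l) x) x :=
    (h.contDiff_Uvec hc ha t 2).contDiffAt
  have h1 : (Δ (synthVel (v t))) x = reVec ((Δ (fun x => fun l => 𝓕 (fun ξ => v t ξ l) x)) x) := by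
    rw [synthVel_eq_comp]
    exact ContDiffAt.laplacian_CLM_comp_left h2
  rw [h1, reVec_apply]
  have h3 : (Δ (fun x => fun l => 𝓕 (fun ξ => v t ξ l) x)) x l =
      (Δ (fun x => 𝓕 (fun ξ => v t ξ l) x)) x := by
    have := ContDiffAt.laplacian_CLM_comp_left (l := ContinuousLinearMap.proj (R := ℝ) l) h2
    exact this.symm
  have h4 : (fun x => 𝓕 (fun ξ => v t ξ l) x) = 𝓕 (fun ξ => v t ξ l) := rfl
  rw [h3, h4, laplacian_fourier_of_moments (fun m _ => h.integrable_pow_mul_norm hc ha m t l)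
    (h.aesm_apply t l) x]

/-! ### The pressure gradient -/

/-- **The pressure gradient** on `[0, T]`: `(∇p(t) x)ₗ = Re 𝓕 (-2πi ξₗ q(t))(x)`. [folklore] -/
theorem IsSobolevMild.gradient_p_apply (h : IsSobolevMild c T a v) (hc : 0 ≤ c) (hT : 0 < T)
    (ha : IsSobolevFourierDatum a) {t : ℝ} (ht : t ∈ Icc 0 T) (x : EuclideanSpace ℝ ι) (l : ι) :
    gradient (fun y => (𝓕 (presSymbol (v t) (v t)) y).re) x l =
      (𝓕 (fun ξ => (-(2 * π * I) * ((ξ l : ℝ) : ℂ)) * presSymbol (v t) (v t) ξ) x).re := by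
  classical
  set q := presSymbol (v t) (v t) with hq
  obtain ⟨B, hB⟩ := h.hasDecay_presSymbol hc hT ha (1 + (Fintype.card ι + 1))
  have hqd : HasDecay (1 + (Fintype.card ι + 1)) B q := (hB t ht).1
  have hqm : AEStronglyMeasurable q volume := (hB t ht).2
  have hdiff : Differentiable ℝ (𝓕 q) := differentiable_fourier' (Nat.lt_succ_self _) hqd hqm
  have h1 : gradient (fun y => (𝓕 q y).re) x l =
      fderiv ℝ (fun y => (𝓕 q y).re) x (EuclideanSpace.single l (1 : ℝ)) := by
    have : gradient (fun y => (𝓕 q y).re) x l =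
        ⟪gradient (fun y => (𝓕 q y).re) x, EuclideanSpace.single l (1 : ℝ)⟫ := by
      rw [EuclideanSpace.inner_single_right]; simp
    rw [this, gradient, InnerProductSpace.toDual_symm_apply]
  have h2 : HasFDerivAt (fun y => (𝓕 q y).re) (Complex.reCLM.comp (fderiv ℝ (𝓕 q) x)) x :=
    Complex.reCLM.hasFDerivAt.comp x (hdiff x).hasFDerivAt
  rw [h1, h2.fderiv, ContinuousLinearMap.comp_apply, Complex.reCLM_apply,
    fderiv_fourier_apply' (Nat.lt_succ_self _) hqd hqm]
  refine congrArg Complex.re (congrFun (fourier_congr' fun ξ => ?_) x)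
  rw [EuclideanSpace.inner_single_right]
  simp

/-! ### The time derivative -/

/-- **The time derivative of the velocity within `[0, T]`**:
`∂ₜ synthVel (v t) x = reVec (𝓕 (-c‖ξ‖² vₗ − N(v,v)ₗ)(x))ₗ`. [folklore] -/
theorem IsSobolevMild.hasDerivWithinAt_u (h : IsSobolevMild c T a v) (hc : 0 ≤ c) (hT : 0 < T)
    (ha : IsSobolevFourierDatum a) (x : EuclideanSpace ℝ ι) {t : ℝ} (ht : t ∈ Icc 0 T) :
    HasDerivWithinAt (fun s => synthVel (v s) x)
      (reVec fun l => 𝓕 (fun ξ => -((c * ‖ξ‖ ^ 2 : ℝ) : ℂ) * v t ξ l -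
        nonlin (v t) (v t) ξ l) x) (Icc 0 T) t := by
  obtain ⟨W, hW0, hW⟩ := h.exists_family hc hT ha 1
  have hU : ∀ l, HasDerivWithinAt (fun s => 𝓕 (fun ξ => v s ξ l) x)
      (𝓕 (fun ξ => -((c * ‖ξ‖ ^ 2 : ℝ) : ℂ) * v t ξ l - nonlin (v t) (v t) ξ l) x)
      (Icc 0 T) t := by
    intro l
    have hd := hasDerivWithinAt_synth_time_dom (n := 0) hT (hW l) x ht
    have hsynth : (fun s => synth (fun k t ξ => W k t ξ l) (s, x)) = fun s => 𝓕 (fun ξ => v s ξ l) x := by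
      funext s; simp only [synth, hW0]
    rw [hsynth] at hd
    -- identify `W 1 t ξ l` with the right-hand side by uniqueness of one-sided derivatives
    have hW1 : ∀ ξ, W 1 t ξ l = -((c * ‖ξ‖ ^ 2 : ℝ) : ℂ) * v t ξ l - nonlin (v t) (v t) ξ l := by
      intro ξ
      have h1 := (hW l).deriv 0 Nat.zero_lt_one ξ t ht
      simp only [hW0, zero_add] at h1
      have h2 := h.hasDerivWithinAt_apply hc ha ξ ht l
      have hud : UniqueDiffWithinAt ℝ (Icc 0 T) t := uniqueDiffOn_Icc hT t ht
      rw [← h1.derivWithin hud, ← h2.derivWithin hud]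
    have hval : synth (fun k => fun t ξ => W (k + 1) t ξ l) (t, x) =
        𝓕 (fun ξ => -((c * ‖ξ‖ ^ 2 : ℝ) : ℂ) * v t ξ l - nonlin (v t) (v t) ξ l) x := by
      simp only [synth, zero_add]
      rw [show (fun ξ => W 1 t ξ l) = fun ξ => -((c * ‖ξ‖ ^ 2 : ℝ) : ℂ) * v t ξ l -
        nonlin (v t) (v t) ξ l from funext hW1]
    rw [hval] at hd
    exact hd
  have hvec : HasDerivWithinAt (fun s => fun l => 𝓕 (fun ξ => v s ξ l) x)
      (fun l => 𝓕 (fun ξ => -((c * ‖ξ‖ ^ 2 : ℝ) : ℂ) * v t ξ l - nonlin (v t) (v t) ξ l) x)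
      (Icc 0 T) t := hasDerivWithinAt_pi.2 hU
  exact (reVec (ι := ι)).hasFDerivAt.comp_hasDerivWithinAt t hvec

/-- The one-sided time derivative of the velocity. [folklore] -/
theorem IsSobolevMild.timeDerivWithin_u (h : IsSobolevMild c T a v) (hc : 0 ≤ c) (hT : 0 < T)
    (ha : IsSobolevFourierDatum a) (x : EuclideanSpace ℝ ι) {t : ℝ} (ht : t ∈ Icc 0 T) :
    timeDerivWithin (Icc 0 T) (fun s => synthVel (v s)) t x =
      reVec fun l => 𝓕 (fun ξ => -((c * ‖ξ‖ ^ 2 : ℝ) : ℂ) * v t ξ l -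
        nonlin (v t) (v t) ξ l) x := by
  rw [timeDerivWithin_apply]
  exact (h.hasDerivWithinAt_u hc hT ha x ht).derivWithin (uniqueDiffOn_Icc hT t ht)

/-! ### The convective term -/

/-- Square integrability of the first-moment components `η ↦ ηⱼ v(t, η)ₗ`. [folklore] -/
theorem IsSobolevMild.memLp_coord_mul_apply (h : IsSobolevMild c T a v) (hc : 0 ≤ c)
    (ha : IsSobolevFourierDatum a) (t : ℝ) (j l : ι) :
    MemLp (fun η : EuclideanSpace ℝ ι => ((η j : ℝ) : ℂ) * v t η l) 2 volume := by
  obtain ⟨G, hG, hle⟩ := h.exists_dom hc ha 1 l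
  refine MemLp.of_le hG.norm ((Continuous.aestronglyMeasurable (by fun_prop)).mul (h.aesm_apply t l))
    (Eventually.of_forall fun η => ?_)
  have h1 := hle t η
  rw [pow_one] at h1
  rw [norm_norm, Real.norm_eq_abs, abs_of_nonneg (le_trans (by positivity) h1), norm_mul,
    Complex.norm_real, Real.norm_eq_abs]
  calc |η j| * ‖v t η l‖ ≤ ‖η‖ * ‖v t η l‖ :=
        mul_le_mul_of_nonneg_right (abs_apply_le_norm η j) (norm_nonneg _)
    _ ≤ (1 + ‖η‖) * ‖v t η l‖ := by gcongr; linarith [norm_nonneg η]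
    _ ≤ G η := h1

/-- **The convective term**: `((u·∇)u (t, x))ₗ = Re 𝓕 (Gₗ(t))(x)` with
`Gₗ = ∑ⱼ (vⱼ ⋆ (-2πi ζⱼ vₗ))` (reality of `𝓕 v`, linearity and the convolution theorem). [folklore] -/
theorem IsSobolevMild.convect_u_apply (h : IsSobolevMild c T a v) (hc : 0 ≤ c)
    (ha : IsSobolevFourierDatum a) (t : ℝ) (x : EuclideanSpace ℝ ι) (l : ι) :
    convect (synthVel (v t)) (synthVel (v t)) x l =
      (𝓕 (fun ξ => ∑ j, fconv (fun η => v t η j)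
        (fun ζ => (-(2 * π * I) * ((ζ j : ℝ) : ℂ)) * v t ζ l) ξ) x).re := by
  have hvj : ∀ j, Integrable fun ξ => v t ξ j := fun j => h.integrable_apply hc ha t j
  have hdv : ∀ j, Integrable fun ζ : EuclideanSpace ℝ ι =>
      (-(2 * π * I) * ((ζ j : ℝ) : ℂ)) * v t ζ l := fun j => by
    have h1 := h.integrable_pow_mul_norm hc ha 1 t l
    simp only [pow_one] at h1
    exact integrable_letterSymbol_mul h1 (h.aesm_apply t l) j
  have hreal : ∀ j, ((synthVel (v t) x j : ℝ) : ℂ) = 𝓕 (fun ξ => v t ξ j) x := fun j => by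
    rw [synthVel_apply]
    exact (fourier_eq_re_of_conj_symm (fun ξ => h.conjSymm t ξ j) x).symm
  rw [convect_apply, h.fderiv_u_apply hc ha]
  congr 1
  -- expand `⟪ξ, u⟫ = ∑ⱼ ξⱼ uⱼ` with `uⱼ` real
  have hexp : (fun ξ : EuclideanSpace ℝ ι =>
      (-(2 * π * I) * (⟪ξ, synthVel (v t) x⟫ : ℂ)) * v t ξ l) =
      fun ξ => ∑ j, 𝓕 (fun η => v t η j) x * ((-(2 * π * I) * ((ξ j : ℝ) : ℂ)) * v t ξ l) := by
    funext ξ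
    rw [ClayDatum.inner_eq_sum', Complex.ofReal_sum]
    simp_rw [Complex.ofReal_mul, hreal]
    rw [Finset.mul_sum, Finset.sum_mul]
    refine Finset.sum_congr rfl fun j _ => ?_
    ring
  rw [hexp]
  have hint : ∀ j ∈ (Finset.univ : Finset ι), Integrable fun ξ : EuclideanSpace ℝ ι =>
      𝓕 (fun η => v t η j) x * ((-(2 * π * I) * ((ξ j : ℝ) : ℂ)) * v t ξ l) :=
    fun j _ => (hdv j).const_mul _
  rw [fourier_finset_sum' Finset.univ hint]
  have hterm : ∀ j, 𝓕 (fun ξ : EuclideanSpace ℝ ι => 𝓕 (fun η => v t η j) x *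
      ((-(2 * π * I) * ((ξ j : ℝ) : ℂ)) * v t ξ l)) x =
      𝓕 (fconv (fun η => v t η j) (fun ζ => (-(2 * π * I) * ((ζ j : ℝ) : ℂ)) * v t ζ l)) x :=
    fun j => by rw [fourier_const_mul', fourier_mul_fourier' (hvj j) (hdv j)]
  simp_rw [hterm]
  have hint2 : ∀ j ∈ (Finset.univ : Finset ι), Integrable
      (fconv (fun η => v t η j) (fun ζ => (-(2 * π * I) * ((ζ j : ℝ) : ℂ)) * v t ζ l)) :=
    fun j _ => integrable_fconv (hvj j) (hdv j)
  rw [← fourier_finset_sum' Finset.univ hint2]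

/-- **Incompressibility inside the convolution**: `Gₗ = -2πi ∑ⱼ ξⱼ (vⱼ ⋆ vₗ)`
(`∑ⱼ ηⱼ vⱼ(η) = 0` under the integral; the convolution integrands are integrable as products of
`L²` functions). [folklore] -/
theorem IsSobolevMild.G_eq (h : IsSobolevMild c T a v) (hc : 0 ≤ c)
    (ha : IsSobolevFourierDatum a) (t : ℝ) (ξ : EuclideanSpace ℝ ι) (l : ι) :
    ∑ j, fconv (fun η => v t η j) (fun ζ => (-(2 * π * I) * ((ζ j : ℝ) : ℂ)) * v t ζ l) ξ =
      -(2 * π * I) * ∑ j, ((ξ j : ℝ) : ℂ) * fconv (fun η => v t η j) (fun η => v t η l) ξ := by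
  have hv2 : ∀ j, MemLp (v t · j) 2 volume := fun j => h.memLp_apply hc ha t j
  -- integrability of the two pieces of each convolution integrand
  have hI1 : ∀ j, Integrable fun η => v t η j * v t (ξ - η) l := fun j =>
    integrable_fconv_integrand (hv2 j) (hv2 l) ξ
  have hI2 : ∀ j, Integrable fun η => (((η j : ℝ) : ℂ) * v t η j) * v t (ξ - η) l := fun j =>
    integrable_fconv_integrand (h.memLp_coord_mul_apply hc ha t j j) (hv2 l) ξ
  -- split each convolution
  have hsplit : ∀ j, fconv (fun η => v t η j) (fun ζ => (-(2 * π * I) * ((ζ j : ℝ) : ℂ)) * v t ζ l) ξ =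
      -(2 * π * I) * (((ξ j : ℝ) : ℂ) * fconv (fun η => v t η j) (fun η => v t η l) ξ) +
        (2 * π * I) * ∫ η, (((η j : ℝ) : ℂ) * v t η j) * v t (ξ - η) l := by
    intro j
    rw [fconv_apply, fconv_apply, ← integral_const_mul, ← integral_const_mul, ← integral_const_mul,
      ← integral_add ((hI1 j).const_mul _ |>.const_mul _) ((hI2 j).const_mul _)]
    refine integral_congr_ae (Eventually.of_forall fun η => ?_)
    simp only [PiLp.sub_apply, Complex.ofReal_sub]
    ring
  simp_rw [hsplit]
  rw [Finset.sum_add_distrib, ← Finset.mul_sum, ← Finset.mul_sum]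
  -- the second sum vanishes by incompressibility of `v t`
  have hzero : ∑ j, ∫ η, (((η j : ℝ) : ℂ) * v t η j) * v t (ξ - η) l = 0 := by
    rw [← integral_finsetSum Finset.univ fun j _ => hI2 j]
    have : (fun η : EuclideanSpace ℝ ι => ∑ j, (((η j : ℝ) : ℂ) * v t η j) * v t (ξ - η) l) =
        fun _ => 0 := by
      funext η
      rw [← Finset.sum_mul, h.divFree t η, zero_mul]
    rw [this, integral_zero]
  rw [hzero, mul_zero, add_zero]

omit [Fintype ι] in
/-- **The Fourier-side momentum identity** (pure algebra of the Leray projection): with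
`C j k = (vⱼ ⋆ v_k)(ξ)`, `-2πi ∑ⱼ ξⱼ C j l − N(v,v)(ξ)ₗ − 2πi ξₗ q(ξ) = 0`
(Lemarié-Rieusset 2016, §6.1). [folklore] -/
theorem momentum_symbol_identity [Fintype ι] (w : EuclideanSpace ℝ ι → ι → ℂ)
    (ξ : EuclideanSpace ℝ ι) (l : ι) :
    (-(2 * π * I) * ∑ j, ((ξ j : ℝ) : ℂ) * fconv (fun η => w η j) (fun η => w η l) ξ) -
      nonlin w w ξ l - (2 * π * I) * ((ξ l : ℝ) : ℂ) * presSymbol w w ξ = 0 := by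
  set C : ι → ι → ℂ := fun j k => fconv (fun η => w η j) (fun η => w η k) ξ with hC
  have hN : nonlin w w ξ l = -(2 * π * I) * ∑ j, ((ξ j : ℝ) : ℂ) * C j l +
      (2 * π * I) * ((ξ l : ℝ) : ℂ) * ∑ j, ∑ k, ((ξ j * ξ k / ‖ξ‖ ^ 2 : ℝ) : ℂ) * C j k := by
    rw [nonlin_apply]
    change -(2 * π * I) * ∑ j, ∑ k, (lerayDerivSymbol j k l ξ : ℂ) * C j k = _
    have hinner : ∀ j, ∑ k, (lerayDerivSymbol j k l ξ : ℂ) * C j k =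
        ((ξ j : ℝ) : ℂ) * C j l - ((ξ l : ℝ) : ℂ) * ∑ k, (((ξ j * ξ k / ‖ξ‖ ^ 2 : ℝ) : ℂ) * C j k) := by
      intro j
      have hk : ∀ k, (lerayDerivSymbol j k l ξ : ℂ) * C j k =
          (if k = l then ((ξ j : ℝ) : ℂ) * C j k else 0) -
            ((ξ l : ℝ) : ℂ) * ((((ξ j * ξ k / ‖ξ‖ ^ 2 : ℝ)) : ℂ) * C j k) := by
        intro k
        rw [lerayDerivSymbol_apply]
        split_ifs with hkl
        · push_cast; ring
        · push_cast; ring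
      simp_rw [hk]
      rw [Finset.sum_sub_distrib, Finset.sum_ite_eq' Finset.univ l, if_pos (Finset.mem_univ l),
        Finset.mul_sum]
    simp_rw [hinner]
    rw [Finset.sum_sub_distrib, mul_sub, Finset.mul_sum, Finset.mul_sum, Finset.mul_sum,
      sub_eq_add_neg, ← Finset.sum_neg_distrib]
    congr 1
    refine Finset.sum_congr rfl fun j _ => ?_
    ring
  have hq : presSymbol w w ξ = -∑ j, ∑ k, ((ξ j * ξ k / ‖ξ‖ ^ 2 : ℝ) : ℂ) * C j k := rfl
  rw [hN, hq]
  ring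

/-! ### The Navier–Stokes system -/

/-- Integrability of the Fourier-side time derivative `-c‖ξ‖² vₗ − Nₗ` on `[0, T]`. [folklore] -/
theorem IsSobolevMild.integrable_Dt (h : IsSobolevMild c T a v) (hc : 0 ≤ c) (hT : 0 < T)
    (ha : IsSobolevFourierDatum a) {t : ℝ} (ht : t ∈ Icc 0 T) (l : ι) :
    Integrable fun ξ : EuclideanSpace ℝ ι =>
      -((c * ‖ξ‖ ^ 2 : ℝ) : ℂ) * v t ξ l - nonlin (v t) (v t) ξ l := by
  have h1 : Integrable fun ξ : EuclideanSpace ℝ ι => -((c * ‖ξ‖ ^ 2 : ℝ) : ℂ) * v t ξ l := by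
    refine ((h.integrable_pow_mul_norm hc ha 2 t l).const_mul c).mono'
      ((Continuous.aestronglyMeasurable (by fun_prop)).mul (h.aesm_apply t l))
      (Eventually.of_forall fun ξ => ?_)
    rw [norm_mul, norm_neg, Complex.norm_real, Real.norm_of_nonneg (by positivity)]
    ring_nf; rfl
  obtain ⟨B, hB⟩ := h.hasDecay_nonlin hc hT ha (Fintype.card ι + 1) l
  exact h1.sub ((hB t ht).1.integrable (finrank_lt_of_card_lt (Nat.lt_succ_self _)) (hB t ht).2)

/-- **The momentum equation** on `[0, T] × E`: `∂ₜu + (u·∇)u = νΔu − ∇p` for `c = 4π²ν`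
(componentwise: linearity of `𝓕` and the symbol identity `G − N − 2πi ξ q = 0`). [folklore] -/
theorem IsSobolevMild.momentum {ν : ℝ} (h : IsSobolevMild (4 * π ^ 2 * ν) T a v) (hν : 0 ≤ ν)
    (hT : 0 < T) (ha : IsSobolevFourierDatum a) {t : ℝ} (ht : t ∈ Icc 0 T) (x : EuclideanSpace ℝ ι) :
    timeDerivWithin (Icc 0 T) (fun s => synthVel (v s)) t x +
        convect (synthVel (v t)) (synthVel (v t)) x =
      ν • (Δ (synthVel (v t))) x - gradient (fun y => (𝓕 (presSymbol (v t) (v t)) y).re) x +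
        (0 : ℝ → EuclideanSpace ℝ ι → EuclideanSpace ℝ ι) t x := by
  have hc : 0 ≤ 4 * π ^ 2 * ν := by positivity
  rw [Pi.zero_apply, Pi.zero_apply, add_zero]
  ext l
  rw [PiLp.add_apply, PiLp.sub_apply, PiLp.smul_apply, h.timeDerivWithin_u hc hT ha x ht,
    reVec_apply, h.convect_u_apply hc ha, h.laplacian_u_apply hc ha, h.gradient_p_apply hc hT ha ht,
    smul_eq_mul]
  -- reduce to an identity of complex Fourier integrals
  rw [← Complex.add_re, ← Complex.re_ofReal_mul, ← Complex.sub_re]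
  congr 1
  -- integrability of the four transformed terms
  have hvj : ∀ j, Integrable fun ξ => v t ξ j := fun j => h.integrable_apply hc ha t j
  have hdv : ∀ j, Integrable fun ζ : EuclideanSpace ℝ ι =>
      (-(2 * π * I) * ((ζ j : ℝ) : ℂ)) * v t ζ l := fun j => by
    have h1 := h.integrable_pow_mul_norm hc ha 1 t l
    simp only [pow_one] at h1
    exact integrable_letterSymbol_mul h1 (h.aesm_apply t l) j
  have hiG : Integrable fun ξ => ∑ j, fconv (fun η => v t η j)
      (fun ζ => (-(2 * π * I) * ((ζ j : ℝ) : ℂ)) * v t ζ l) ξ :=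
    integrable_finsetSum _ fun j _ => integrable_fconv (hvj j) (hdv j)
  have hilap : Integrable fun ξ : EuclideanSpace ℝ ι =>
      (-(4 * π ^ 2 * ‖ξ‖ ^ 2 : ℝ) : ℂ) * v t ξ l := by
    refine ((h.integrable_pow_mul_norm hc ha 2 t l).const_mul (4 * π ^ 2)).mono'
      ((Continuous.aestronglyMeasurable (by fun_prop)).mul (h.aesm_apply t l))
      (Eventually.of_forall fun ξ => ?_)
    rw [norm_mul, norm_neg, Complex.norm_real, Real.norm_of_nonneg (by positivity)]
    ring_nf; rfl
  have higradq : Integrable fun ξ : EuclideanSpace ℝ ι =>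
      (-(2 * π * I) * ((ξ l : ℝ) : ℂ)) * presSymbol (v t) (v t) ξ := by
    obtain ⟨B, hB⟩ := h.hasDecay_presSymbol hc hT ha (1 + (Fintype.card ι + 1))
    have hq1 : Integrable fun ξ : EuclideanSpace ℝ ι => ‖ξ‖ * ‖presSymbol (v t) (v t) ξ‖ := by
      simpa using (hB t ht).1.integrable_pow_mul_norm (n := 1)
        (finrank_lt_of_card_lt (Nat.lt_succ_self _)) (hB t ht).2
    exact integrable_letterSymbol_mul hq1 (hB t ht).2 l
  rw [← fourier_add' (h.integrable_Dt hc hT ha ht l) hiG, ← fourier_const_mul' (ν : ℂ),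
    ← fourier_sub' (hilap.const_mul _) higradq]
  refine congrFun (fourier_congr' fun ξ => ?_) x
  simp only [Pi.add_apply, Pi.sub_apply]
  have key := momentum_symbol_identity (v t) ξ l
  rw [h.G_eq hc ha t ξ l]
  have hcν : (((4 * π ^ 2 * ν) * ‖ξ‖ ^ 2 : ℝ) : ℂ) = (ν : ℂ) * ((4 * π ^ 2 * ‖ξ‖ ^ 2 : ℝ) : ℂ) := by
    push_cast; ring
  rw [hcν]
  linear_combination key

/-- **`(u, p)` is a classical solution of the unforced Navier–Stokes system with viscosity `ν` on
the closed slab `[0, T] × E`**, `u(t) = synthVel (v t)`, `p(t) = Re 𝓕 presSymbol (v t) (v t)`,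
for every Fourier-side mild solution of Sobolev class with heat rate `c = 4π²ν` (Tao 2011,
Thm. 5.4 (iv): the `H¹` mild solution with `H^∞` datum is smooth and solves (3)–(5) on
`[0, T] × ℝ³`; Leray 1934, §19). [cite: Tao2011, Thm. 5.4 (iv)] -/
theorem IsSobolevMild.isClassicalNSSolutionOn {ν : ℝ} (h : IsSobolevMild (4 * π ^ 2 * ν) T a v)
    (hν : 0 ≤ ν) (hT : 0 < T) (ha : IsSobolevFourierDatum a) :
    IsClassicalNSSolutionOn (Icc 0 T) ν 0 (fun t => synthVel (v t))
      (fun t x => (𝓕 (presSymbol (v t) (v t)) x).re) where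
  smooth_velocity := h.smooth_u (by positivity) hT ha
  smooth_pressure := h.smooth_p (by positivity) hT ha
  momentum _ ht x := h.momentum hν hT ha ht x
  divFree t _ := h.isDivFree_u (by positivity) ha t

end Solution

end Literature.Analysis.FluidPDE.FourierNS

end
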